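import Mathlib
import Summits.Ventures.HodgeRepro2.T5QuadraticAutomorphism
import Summits.Ventures.HodgeRepro2.T5QuadraticInvolution
import Summits.Ventures.HodgeRepro2.T5CharactersTrivialOnBase

/-!
# The basis `(1, δ)` of a quadratic extension from a non-trivial automorphism

`F ⊆ E` fields with `[E : F] = 2`, `2 ≠ 0` in `E`, `σ : E ≃ₐ[F] E` with `σ ≠ 1`.  By
`T5QuadraticAutomorphism`, `σ` is an involution with fixed field `F`; for any `s ∉ F`,
`δ := s − σ s` is a non-zero anti-invariant element, and `T5QuadraticInvolution` (the linear-algebra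
half of (A1′)) gives `E = F ⊕ F δ` with unique coordinates, i.e. a basis `(1, δ)` in the form
`T5CharactersTrivialOnBase.basisOfSpanUniq` expects:

* `exists_notMem_range`: `[E : F] = 2` ⇒ some `s ∉ F`;
* `exists_anti_ne_zero`: ⇒ some `δ ≠ 0` with `σ δ = −δ`;
* `exists_basis`: ⇒ ∃ `b : Basis (Fin 2) F E` with `b 0 = 1` and `σ (b 1) = −b 1`.

Declaration per README §8(d): «uses an L-value-free non-vanishing device: NO».
-/

namespace Summit.Ventures.HodgeRepro2.T5QuadraticBasis

open T5QuadraticAutomorphism T5QuadraticInvolution T5CharactersTrivialOnBase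

variable {F E : Type*} [Field F] [Field E] [Algebra F E]

/-- `[E : F] = 2` ⇒ some element lies outside `F`. -/
theorem exists_notMem_range (h2 : Module.finrank F E = 2) :
    ∃ s : E, s ∉ Set.range (algebraMap F E) := by
  by_contra h
  have hbot : (⊥ : IntermediateField F E) = ⊤ := by
    apply IntermediateField.ext
    intro y
    simp only [IntermediateField.mem_top, iff_true]
    rw [IntermediateField.mem_bot]
    exact by_contra fun hy => h ⟨y, hy⟩
  rw [IntermediateField.bot_eq_top_iff_finrank_eq_one] at hbot
  omega

variable [FiniteDimensional F E]

/-- A non-zero anti-invariant element `δ = s − σ s`. -/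
theorem exists_anti_ne_zero (h2 : Module.finrank F E = 2) (σ : E ≃ₐ[F] E) (hσ : σ ≠ 1) :
    ∃ δ : E, σ δ = -δ ∧ δ ≠ 0 := by
  obtain ⟨s, hs⟩ := exists_notMem_range h2
  refine ⟨s - σ s, ?_, ?_⟩
  · rw [map_sub, apply_apply h2 σ hσ, neg_sub]
  · intro h
    rw [sub_eq_zero] at h
    exact hs (mem_range_of_fixed h2 σ hσ h.symm)

/-- THE BASIS `(1, δ)`: `∃ b : Basis (Fin 2) F E`, `b 0 = 1`, `σ (b 1) = −b 1`. -/
theorem exists_basis [NeZero (2 : E)] (h2 : Module.finrank F E = 2) (σ : E ≃ₐ[F] E)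
    (hσ : σ ≠ 1) :
    ∃ b : Module.Basis (Fin 2) F E, b 0 = 1 ∧ σ (b 1) = -b 1 := by
  obtain ⟨δ, hδ, hδ0⟩ := exists_anti_ne_zero h2 σ hσ
  have hspan := exists_eq_add_mul (σ : E →ₐ[F] E) (apply_apply h2 σ hσ)
    (fun x hx => mem_range_of_fixed h2 σ hσ hx) hδ hδ0
  have huniq : ∀ a c : F, algebraMap F E a + algebraMap F E c * δ = 0 → a = 0 ∧ c = 0 :=
    fun a c h => eq_zero_of_add_mul_eq_zero (σ : E →ₐ[F] E) hδ hδ0 h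
  refine ⟨basisOfSpanUniq δ hspan huniq, basisOfSpanUniq_zero δ hspan huniq, ?_⟩
  rw [basisOfSpanUniq_one δ hspan huniq]
  exact hδ

end Summit.Ventures.HodgeRepro2.T5QuadraticBasis
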